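import Literature.Topology.FourManifolds.TrisectionFunctorGKStabilizationKernel
import Literature.AlgebraicTopology.FundamentalGroup.VanKampenClosedCoverPushout
import HarnessLib

/-!
# Stabilisation compatibility of the Abrams–Gay–Kirby functor: the `π₁` stage of the geometric
# half of fact (c′), assembled from Seifert–van Kampen

Topic `Literature/Topology/FourManifolds`; third sibling of `TrisectionFunctorGK.lean` for the
fact seat `provefact-Literature.Topology.FourManifolds.exists-14560f9fc8` (named fact (c′)
`Literature.Topology.FourManifolds.exists_stabilized_gkTrisection`), after
`TrisectionFunctorGKStabilization.lean` (algebraic half) and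
`TrisectionFunctorGKStabilizationKernel.lean` (kernel computation from abstract van Kampen data).

## What this file proves (sorry-free, theorems only, no definitions, no named facts)

Gay–Kirby's stabilisation (Def. 8) of a trisection `S` of `X` modifies it inside a small ball
around a point of the central surface `F`; with `D ⊆ F` a closed disc containing the six arc
ends and with the base point `x₀ ∈ C = ∂D`, the new central surface and handlebodies decompose
into closed pieces (notation of the sibling files)

  `F′ = A ∪ P`, `A ∩ P = C`, `A = F ∖ D̊`, `P ≅ Σ₃ ∖ disc`;
  `H′ᵢ = A^Hᵢ ∪ B^Hᵢ`, `A^Hᵢ ∩ B^Hᵢ = Eᵢ` a disc, `A ⊆ A^Hᵢ = Hᵢ ∖ half-ball ⊆ Hᵢ`, `P ⊆ B^Hᵢ`.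

Here the whole `π₁` COMPUTATION of Gay–Kirby's Lemma 10 / Abrams–Gay–Kirby's Thm. 5
("connected sums of group trisections map to connected sums of 4-manifold trisections") is
carried out from such a decomposition, by the Seifert–van Kampen theorem for closed pieces with
collars in its universal-property form (`VanKampen.existsUnique_hom_of_closed_cover_collars`,
`VanKampenClosedCoverPushout.lean`):

* `exists_marking_of_closed_cover_collars` — **the marking of the stabilised central surface.**
  From free bases `θ_A : F⟨a₁,…,b_g⟩ ≃* π₁(A, x₀)`, `θ_P : F⟨a₁,…,b₃⟩ ≃* π₁(P, x₀)` in which a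
  generator of `π₁(C, x₀)` reads `r_g`, resp. `r₃⁻¹`, van Kampen (pushout over `π₁ C`) and
  `surfaceGroup_exists_mulEquiv_of_pushout` give `μ′ : S_{g+3} ≃* π₁(A ∪ P, x₀)` reading the
  first `g` handles through `θ_A` and the last three through `θ_P`;
* `exists_geometric_marking_of_closed_cover_collars` — **the geometric marking `μ₀` of the old
  central surface `F = A ∪_C D`** (`D` a disc): `π₁ A ↠ π₁ F` with kernel `⟪t⟫` (Hatcher,
  Prop. 1.26 (a), via `VanKampen.surjective_and_ker_eq_of_closed_cover_collars_of_subsingleton_right`),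
  whence `μ₀ : S_g ≃* π₁(F, x₀)` through `θ_A`;
* `comap_ker_eq_stabilize_of_closed_covers` — **one kernel slot.**  For sets
  `W₀ ⊆ V₀` (old `F ⊆ Hᵢ`), `W = A ∪ P ⊆ V = A^H ∪ B^H` (new `F′ ⊆ H′ᵢ`) with the closed-cover
  hypotheses for `V`, `π₁(E, x₀) = 1`, markings `μ₀` of `π₁ W₀` (through `θ_A`) and `μ′` of
  `π₁ W` (through `θ_A`, `θ_P`), and the three geometric `π₁` facts — `π₁ A → π₁ A^H` onto,
  `π₁ A^H → π₁ V₀` injective, `π₁ P → π₁ B^H` onto with kernel (read in `F⟨a₁,…,b₃⟩`) the normal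
  closure of the three cut curves `s4Gens i` and `r₃` —:
  `μ′⁻¹(ker (π₁ W → π₁ V)) = (K).stabilize i` whenever `K i = μ₀⁻¹(ker (π₁ W₀ → π₁ V₀))`
  (van Kampen across the disc `E`: `π₁ V = π₁ A^H ∗ π₁ B^H`, then
  `surfaceGroup_ker_eq_stabilize`);
* `map_centralInclusion_eq_inclHomOfSubset` — Mathlib's `FundamentalGroup.map` of the inclusion
  of the central surface in a handlebody is the tree's `VanKampen.inclHomOfSubset`;
* `exists_marking_groupGKTrisectionOf_eq_stabilize` — **the `π₁` stage of (c′), assembled**: for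
  Gay–Kirby trisections `S` (genus `g`) and `S′` (genus `g + 3`) of `X` whose central surfaces
  and handlebodies are related by such decompositions (all hypotheses are about subsets of `X`,
  inclusion-induced maps of fundamental groups, collars and path connectivity), there is a
  marking `μ′` of the central surface of `S′` at `x₀` with
  `𝒢(h′, x₀, μ′) = (𝒢(h, x₀, μ₀)).stabilize` ON THE NOSE; with
  `exists_iso_stabilize_of_eq` / `exists_stabilized_gkTrisection_of_lift` this is the
  hypothesis `hgeom` of the glue theorems of `TrisectionFunctorGKStabilization.lean`.

What remains for the geometric half of (c′) after this file is differential topology only: the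
construction of `S′` over `IsBalancedGKTrisection` (sectors with corner charts and Morse counts
`(1, k+1)`, handlebodies `(1, g+3)`) and the verification of the listed properties of the pieces
(collars, path connectivity, `π₁` of `A`, `P` free on the stated bases — `P` a disc with six
holes and three tubes —, `π₁ Eᵢ = 1`, `π₁(Hᵢ ∖ half-ball) → π₁ Hᵢ` injective, surjectivity of
`π₁ A → π₁ A^Hᵢ`, and the cut-curve kernel of the genus-`3` chunk `B^Hᵢ`).  (c′) stays a named
fact.

## References

* D. Gay, R. Kirby, *Trisecting 4-manifolds*, Geom. Topol. 20 (2016): Def. 8, Lemma 10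
  (p. 3100). [GayKirby2016]
* A. Abrams, D. Gay, R. Kirby, *Group trisections and smooth 4-manifolds*, Geom. Topol. 22
  (2018): Def. 2–3 (pp. 1539–1540), Thm. 5 (p. 1541) and its proof (p. 1542). [AbramsGayKirby2018]
* A. Hatcher, *Algebraic Topology*, CUP (2002), §1.2, Thm. 1.20, Prop. 1.17. [HatcherAT2002]
-/

noncomputable section

open Set Subgroup
open Literature.AlgebraicTopology.FundamentalGroup.VanKampen
open scoped Manifold ContDiff

namespace Literature.Topology.FourManifolds

universe u

/-! ### The marking of the stabilised central surface -/

section Marking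

variable {X : Type u} [TopologicalSpace X] {g : ℕ}

/-- **The marking of the stabilised central surface `F′ = A ∪_C P`.**  Let `A, P ⊆ X` be closed,
meeting exactly in `C ∋ x₀`, with collars of `C` on both sides (`C ⊆ C_A ⊆ A` open in `A` and
strong deformation retracting onto `C`, likewise in `P`), `A`, `P`, `C` path connected, and
`π₁(C, x₀)` generated by one element `t` (a circle).  Let `θ_A : F⟨a₁,…,b_g⟩ ≃* π₁(A, x₀)` and
`θ_P : F⟨a₁,…,b₃⟩ ≃* π₁(P, x₀)` be free bases with `θ_A(r_g) = t` (read in `A`) and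
`θ_P(r₃) = t⁻¹` (read in `P`).  Then for every `W = A ∪ P` there is an isomorphism
`μ′ : S_{g+3} ≃* π₁(W, x₀)` which on the first `g` handles is `θ_A` followed by `π₁ A → π₁ W` and
on the last three is `θ_P` followed by `π₁ P → π₁ W` — Seifert–van Kampen for the closed cover
(`VanKampen.existsUnique_hom_of_closed_cover_collars`) and `S_{g+3} = F_{2g} *_ℤ F₆`
(`surfaceGroup_exists_mulEquiv_of_pushout`).  This is the marking in which the kernel triple of
the stabilised trisection is computed on the nose.
[cite: HatcherAT2002, Thm. 1.20 and §1.2 p. 51] [cite: AbramsGayKirby2018, Def. 2–3 (pp. 1539–1540)] -/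
theorem exists_marking_of_closed_cover_collars {A P C CA CP OA OP W : Set X}
    (hA : IsClosed A) (hP : IsClosed P) (hCA : C ⊆ A) (hCP : C ⊆ P) (hC : A ∩ P ⊆ C)
    (hOA : IsOpen OA) (hCAe : CA = A ∩ OA) (hCCA : C ⊆ CA)
    (hOP : IsOpen OP) (hCPe : CP = P ∩ OP) (hCCP : C ⊆ CP)
    (hsdrA : Literature.AlgebraicTopology.Homotopy.IsStrongDeformationRetractOf C CA)
    (hsdrP : Literature.AlgebraicTopology.Homotopy.IsStrongDeformationRetractOf C CP)
    (hApc : IsPathConnected A) (hPpc : IsPathConnected P) (hCpc : IsPathConnected C)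
    {x₀ : X} (hx₀ : x₀ ∈ C) (eW : A ∪ P = W)
    (t : _root_.FundamentalGroup C ⟨x₀, hx₀⟩) (ht : Subgroup.closure {t} = ⊤)
    (θA : FreeGroup (surfaceGen g) ≃* _root_.FundamentalGroup A ⟨x₀, hCA hx₀⟩)
    (θP : FreeGroup (surfaceGen 3) ≃* _root_.FundamentalGroup P ⟨x₀, hCP hx₀⟩)
    (hθA : θA (surfaceRelator g) = inclHomOfSubset hCA x₀ hx₀ (hCA hx₀) t)
    (hθP : θP (surfaceRelator 3) = (inclHomOfSubset hCP x₀ hx₀ (hCP hx₀) t)⁻¹) :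
    ∃ (hxW : x₀ ∈ W) (hAW : A ⊆ W) (hPW : P ⊆ W)
      (μ' : SurfaceGroup (g + 3) ≃* _root_.FundamentalGroup W ⟨x₀, hxW⟩),
      μ'.toMonoidHom.comp ((PresentedGroup.mk _).comp (genIncl g)) =
          (inclHomOfSubset hAW x₀ (hCA hx₀) hxW).comp θA.toMonoidHom ∧
        μ'.toMonoidHom.comp ((PresentedGroup.mk _).comp (genShift g)) =
          (inclHomOfSubset hPW x₀ (hCP hx₀) hxW).comp θP.toMonoidHom := by
  subst eW
  have hxA : x₀ ∈ A := hCA hx₀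
  have hxP : x₀ ∈ P := hCP hx₀
  have hxW : x₀ ∈ A ∪ P := Or.inl hxA
  refine ⟨hxW, subset_union_left, subset_union_right, ?_⟩
  -- the two legs of the span, read in `π₁(A ∪ P)`
  set u : FreeGroup (surfaceGen g) →* _root_.FundamentalGroup ↥(A ∪ P) ⟨x₀, hxW⟩ :=
    (inclHomOfSubset (subset_union_left : A ⊆ A ∪ P) x₀ hxA hxW).comp θA.toMonoidHom with hu
  set v : FreeGroup (surfaceGen 3) →* _root_.FundamentalGroup ↥(A ∪ P) ⟨x₀, hxW⟩ :=
    (inclHomOfSubset (subset_union_right : P ⊆ A ∪ P) x₀ hxP hxW).comp θP.toMonoidHom with hv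
  -- the seam relation `u(r_g) · v(r₃) = 1`
  have huv : u (surfaceRelator g) * v (surfaceRelator 3) = 1 := by
    rw [hu, hv, MonoidHom.comp_apply, MonoidHom.comp_apply, MulEquiv.coe_toMonoidHom,
      MulEquiv.coe_toMonoidHom, hθA, hθP, map_inv,
      inclHomOfSubset_inclHomOfSubset hCA subset_union_left hx₀ hxA hxW,
      inclHomOfSubset_inclHomOfSubset hCP subset_union_right hx₀ hxP hxW, mul_inv_cancel]
  -- the cone into `S_{g+3}`
  let φ₁ : _root_.FundamentalGroup A ⟨x₀, hxA⟩ →* SurfaceGroup (g + 3) :=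
    ((PresentedGroup.mk _).comp (genIncl g)).comp θA.symm.toMonoidHom
  let φ₂ : _root_.FundamentalGroup P ⟨x₀, hxP⟩ →* SurfaceGroup (g + 3) :=
    ((PresentedGroup.mk _).comp (genShift g)).comp θP.symm.toMonoidHom
  have hφ₁ : φ₁.comp θA.toMonoidHom = (PresentedGroup.mk _).comp (genIncl g) :=
    MonoidHom.ext fun x => by simp [φ₁]
  have hφ₂ : φ₂.comp θP.toMonoidHom = (PresentedGroup.mk _).comp (genShift g) :=
    MonoidHom.ext fun x => by simp [φ₂]
  have compat : φ₁.comp (inclHomOfSubset hCA x₀ hx₀ hxA) = φ₂.comp (inclHomOfSubset hCP x₀ hx₀ hxP) := by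
    refine MonoidHom.eq_of_eqOn_dense ht ?_
    intro s hs
    rw [Set.mem_singleton_iff] at hs
    subst hs
    have h1 : θA.symm (inclHomOfSubset hCA x₀ hx₀ hxA s) = surfaceRelator g := by
      rw [MulEquiv.symm_apply_eq, hθA]
    have h2 : θP.symm (inclHomOfSubset hCP x₀ hx₀ hxP s) = (surfaceRelator 3)⁻¹ := by
      rw [MulEquiv.symm_apply_eq, map_inv, hθP, inv_inv]
    change PresentedGroup.mk _ (genIncl g (θA.symm (inclHomOfSubset hCA x₀ hx₀ hxA s))) =
      PresentedGroup.mk _ (genShift g (θP.symm (inclHomOfSubset hCP x₀ hx₀ hxP s)))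
    rw [h1, h2, map_inv, map_inv, eq_inv_iff_mul_eq_one]
    exact mk_genIncl_surfaceRelator_mul_mk_genShift g
  obtain ⟨Φ, ⟨hΦ₁, hΦ₂⟩, -⟩ := existsUnique_hom_of_closed_cover_collars hA hP hCA hCP hC hOA hCAe
    hCCA hOP hCPe hCCP hsdrA hsdrP hApc hPpc hCpc hx₀ φ₁ φ₂ compat
  -- `S_{g+3}` is the pushout
  refine surfaceGroup_exists_mulEquiv_of_pushout u v huv ⟨Φ, ?_, ?_⟩ ?_
  · rw [hu, ← MonoidHom.comp_assoc, hΦ₁, hφ₁]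
  · rw [hv, ← MonoidHom.comp_assoc, hΦ₂, hφ₂]
  · intro F F' hFu hFv
    have hθAs : Function.Surjective θA.toMonoidHom := θA.surjective
    have hθPs : Function.Surjective θP.toMonoidHom := θP.surjective
    refine hom_ext_of_closed_cover_collars hA hP hCA hCP hC hOA hCAe hCCA hOP hCPe hCCP hsdrA hsdrP
      hApc hPpc hCpc hx₀ ?_ ?_
    · rw [← MonoidHom.cancel_right hθAs, MonoidHom.comp_assoc, MonoidHom.comp_assoc]
      exact hFu
    · rw [← MonoidHom.cancel_right hθPs, MonoidHom.comp_assoc, MonoidHom.comp_assoc]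
      exact hFv


/-- **The geometric marking of the OLD central surface `F = A ∪_C D`** (the hypothesis `hμ₀` of
the slot and assembly theorems below, discharged from the pieces).  Let `A, D ⊆ X` be closed,
meeting exactly in `C ∋ x₀`, with collars of `C` in `A` and in `D`, `A`, `D`, `C` path connected,
`π₁(D, x₀) = 1` (a disc) and `π₁(C, x₀)` generated by `t`; let `θ_A : F⟨a₁,…,b_g⟩ ≃* π₁(A, x₀)`
be a free basis with `θ_A(r_g) = t`.  Then for every `W₀ = A ∪ D` there is a marking
`μ₀ : S_g ≃* π₁(W₀, x₀)` reading words through `θ_A` and `π₁ A → π₁ W₀`: the inclusion induces a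
surjection with kernel `⟪t⟫` (`VanKampen.surjective_and_ker_eq_of_closed_cover_collars_of_subsingleton_right`,
Hatcher Prop. 1.26 (a)), and `surfaceGroup_exists_mulEquiv_of_basis_of_surjective`.
[cite: HatcherAT2002, Prop. 1.26 and §1.2 p. 51] -/
theorem exists_geometric_marking_of_closed_cover_collars {A D C CA CD OA OD W₀ : Set X}
    (hA : IsClosed A) (hD : IsClosed D) (hCA : C ⊆ A) (hCD : C ⊆ D) (hC : A ∩ D ⊆ C)
    (hOA : IsOpen OA) (hCAe : CA = A ∩ OA) (hCCA : C ⊆ CA)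
    (hOD : IsOpen OD) (hCDe : CD = D ∩ OD) (hCCD : C ⊆ CD)
    (hsdrA : Literature.AlgebraicTopology.Homotopy.IsStrongDeformationRetractOf C CA)
    (hsdrD : Literature.AlgebraicTopology.Homotopy.IsStrongDeformationRetractOf C CD)
    (hApc : IsPathConnected A) (hDpc : IsPathConnected D) (hCpc : IsPathConnected C)
    {x₀ : X} (hx₀ : x₀ ∈ C) [Subsingleton (_root_.FundamentalGroup D ⟨x₀, hCD hx₀⟩)]
    (eW₀ : A ∪ D = W₀)
    (t : _root_.FundamentalGroup C ⟨x₀, hx₀⟩) (ht : Subgroup.closure {t} = ⊤)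
    (θA : FreeGroup (surfaceGen g) ≃* _root_.FundamentalGroup A ⟨x₀, hCA hx₀⟩)
    (hθA : θA (surfaceRelator g) = inclHomOfSubset hCA x₀ hx₀ (hCA hx₀) t) :
    ∃ (hxW₀ : x₀ ∈ W₀) (hAW₀ : A ⊆ W₀) (μ₀ : SurfaceGroup g ≃* _root_.FundamentalGroup W₀ ⟨x₀, hxW₀⟩),
      μ₀.toMonoidHom.comp (PresentedGroup.mk _) =
        (inclHomOfSubset hAW₀ x₀ (hCA hx₀) hxW₀).comp θA.toMonoidHom := by
  subst eW₀
  obtain ⟨hs, hk⟩ := surjective_and_ker_eq_of_closed_cover_collars_of_subsingleton_right hA hD hCA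
    hCD hC hOA hCAe hCCA hOD hCDe hCCD hsdrA hsdrD hApc hDpc hCpc hx₀
  refine ⟨Or.inl (hCA hx₀), subset_union_left, ?_⟩
  refine surfaceGroup_exists_mulEquiv_of_basis_of_surjective θA _ hs ?_
  rw [hk, hθA]
  -- `⟪range (π₁ C → π₁ A)⟫ = ⟪t⟫` since `π₁ C = ⟨t⟩`
  have hr : Set.range (inclHomOfSubset hCA x₀ hx₀ (hCA hx₀)) =
      (Subgroup.closure {inclHomOfSubset hCA x₀ hx₀ (hCA hx₀) t} : Set _) := by
    rw [← MonoidHom.coe_range, MonoidHom.range_eq_map, ← ht, MonoidHom.map_closure,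
      Set.image_singleton]
  rw [hr]
  apply le_antisymm
  · exact Subgroup.normalClosure_le_normal (Subgroup.closure_le_normalClosure)
  · exact Subgroup.normalClosure_mono Subgroup.subset_closure

end Marking

/-! ### One kernel slot from closed-cover data -/

section Slot

variable {X : Type u} [TopologicalSpace X] {g : ℕ}

/-- **One kernel slot of the stabilised trisection, from the closed pieces.**  Sets: `W₀ ⊆ V₀`
(old central surface inside the old handlebody `Hᵢ`), `A ⊆ W₀` (old surface minus the disc),
`W ⊆ V` (new central surface inside the new handlebody `H′ᵢ`), `V = A^H ∪ B^H` a closed cover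
meeting exactly in `E ∋ x₀` with collars, `A^H`, `B^H`, `E` path connected and `π₁(E, x₀) = 1`
(a disc), `A ⊆ A^H ⊆ V₀`, `P ⊆ B^H`.  Markings: `μ₀ : S_g ≃* π₁(W₀, x₀)` reading words through
`θ_A : F⟨a₁,…,b_g⟩ → π₁(A, x₀)`, and `μ′ : S_{g+3} ≃* π₁(W, x₀)` reading the first `g` handles
through `θ_A` and the last three through `θ_P : F⟨a₁,…,b₃⟩ → π₁(P, x₀)`
(`exists_marking_of_closed_cover_collars`).  Geometric `π₁` inputs: `π₁ A → π₁ A^H` onto (on the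
image of `θ_A`), `π₁ A^H → π₁ V₀` injective (a half-ball bite), `π₁ P → π₁ B^H` onto (on the image
of `θ_P`) with kernel, read in the free group, the normal closure of the cut curves `s4Gens i` and
`r₃`.  Conclusion: `μ′⁻¹ (ker (π₁ W → π₁ V)) = K.stabilize i` for any triple `K` with
`K i = μ₀⁻¹ (ker (π₁ W₀ → π₁ V₀))` — van Kampen across the disc `E`
(`VanKampen.exists_hom_of_closed_cover_collars_of_subsingleton`: `π₁ V = π₁ A^H ∗ π₁ B^H`) and
`surfaceGroup_ker_eq_stabilize`.
[cite: AbramsGayKirby2018, Def. 2–3 (pp. 1539–1540) and Thm. 5 (p. 1541)]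
[cite: GayKirby2016, Def. 8 and Lemma 10 (p. 3100)] -/
theorem comap_ker_eq_stabilize_of_closed_covers
    {A P W W₀ V₀ AH BH E CA CB OA OB V : Set X} {x₀ : X}
    -- the new handlebody as a closed cover `V = A^H ∪ B^H` glued along the disc `E`
    (hAH : IsClosed AH) (hBH : IsClosed BH) (hEAH : E ⊆ AH) (hEBH : E ⊆ BH) (hE : AH ∩ BH ⊆ E)
    (hOA : IsOpen OA) (hCAe : CA = AH ∩ OA) (hECA : E ⊆ CA)
    (hOB : IsOpen OB) (hCBe : CB = BH ∩ OB) (hECB : E ⊆ CB)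
    (hsdrA : Literature.AlgebraicTopology.Homotopy.IsStrongDeformationRetractOf E CA)
    (hsdrB : Literature.AlgebraicTopology.Homotopy.IsStrongDeformationRetractOf E CB)
    (hAHpc : IsPathConnected AH) (hBHpc : IsPathConnected BH) (hEpc : IsPathConnected E)
    (hx₀E : x₀ ∈ E) [Subsingleton (_root_.FundamentalGroup E ⟨x₀, hx₀E⟩)] (eV : AH ∪ BH = V)
    -- positions of the pieces
    (hxA : x₀ ∈ A) (hxP : x₀ ∈ P) (hAW₀ : A ⊆ W₀) (hW₀V₀ : W₀ ⊆ V₀) (hAAH : A ⊆ AH)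
    (hAHV₀ : AH ⊆ V₀) (hPBH : P ⊆ BH) (hAW : A ⊆ W) (hPW : P ⊆ W) (hWV : W ⊆ V)
    -- markings
    (θA : FreeGroup (surfaceGen g) →* _root_.FundamentalGroup A ⟨x₀, hxA⟩)
    (θP : FreeGroup (surfaceGen 3) →* _root_.FundamentalGroup P ⟨x₀, hxP⟩)
    (μ₀ : SurfaceGroup g ≃* _root_.FundamentalGroup W₀ ⟨x₀, hAW₀ hxA⟩)
    (hμ₀ : μ₀.toMonoidHom.comp (PresentedGroup.mk _) = (inclHomOfSubset hAW₀ x₀ hxA (hAW₀ hxA)).comp θA)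
    (μ' : SurfaceGroup (g + 3) ≃* _root_.FundamentalGroup W ⟨x₀, hAW hxA⟩)
    (hμ'A : μ'.toMonoidHom.comp ((PresentedGroup.mk _).comp (genIncl g)) =
      (inclHomOfSubset hAW x₀ hxA (hAW hxA)).comp θA)
    (hμ'P : μ'.toMonoidHom.comp ((PresentedGroup.mk _).comp (genShift g)) =
      (inclHomOfSubset hPW x₀ hxP (hAW hxA)).comp θP)
    -- the old kernel
    (K : TrisectionKernels g) (i : Fin 3)
    (hK : K i = ((inclHomOfSubset hW₀V₀ x₀ (hAW₀ hxA) (hW₀V₀ (hAW₀ hxA))).ker).comap μ₀.toMonoidHom)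
    -- the geometric `π₁` inputs
    (hsA : Function.Surjective ((inclHomOfSubset hAAH x₀ hxA (hAAH hxA)).comp θA))
    (hjA : Function.Injective (inclHomOfSubset hAHV₀ x₀ (hAAH hxA) (hAHV₀ (hAAH hxA))))
    (hsP : Function.Surjective ((inclHomOfSubset hPBH x₀ hxP (hPBH hxP)).comp θP))
    (hkP : (((inclHomOfSubset hPBH x₀ hxP (hPBH hxP)).comp θP).ker : Set (FreeGroup (surfaceGen 3))) =
      (normalClosure (FreeGroup.of '' (s4Gens i : Set (surfaceGen 3)) ∪ {surfaceRelator 3}) :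
        Set (FreeGroup (surfaceGen 3)))) :
    ((inclHomOfSubset hWV x₀ (hAW hxA) (hWV (hAW hxA))).ker).comap μ'.toMonoidHom = K.stabilize i := by
  subst eV
  have hxAH : x₀ ∈ AH := hAAH hxA
  have hxBH : x₀ ∈ BH := hPBH hxP
  have hxV : x₀ ∈ AH ∪ BH := hWV (hAW hxA)
  -- `π₁ V = π₁ A^H ∗ π₁ B^H` (van Kampen across the disc `E`)
  have hcop : ∀ (T : Type) [Group T] (f : _root_.FundamentalGroup AH ⟨x₀, hxAH⟩ →* T)
      (f' : _root_.FundamentalGroup BH ⟨x₀, hxBH⟩ →* T),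
      ∃ Φ : _root_.FundamentalGroup ↥(AH ∪ BH) ⟨x₀, hxV⟩ →* T,
        Φ.comp (inclHomOfSubset (subset_union_left : AH ⊆ AH ∪ BH) x₀ hxAH hxV) = f ∧
          Φ.comp (inclHomOfSubset (subset_union_right : BH ⊆ AH ∪ BH) x₀ hxBH hxV) = f' :=
    fun T _ f f' => exists_hom_of_closed_cover_collars_of_subsingleton hAH hBH hEAH hEBH hE hOA hCAe
      hECA hOB hCBe hECB hsdrA hsdrB hAHpc hBHpc hEpc hx₀E f f'
  rw [MonoidHom.comap_ker]
  refine surfaceGroup_ker_eq_stabilize K i _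
    (inclHomOfSubset (subset_union_left : AH ⊆ AH ∪ BH) x₀ hxAH hxV)
    (inclHomOfSubset (subset_union_right : BH ⊆ AH ∪ BH) x₀ hxBH hxV) hcop
    ((inclHomOfSubset hAAH x₀ hxA hxAH).comp θA) ((inclHomOfSubset hPBH x₀ hxP hxBH).comp θP)
    hsA hsP ?_ ?_ ?_ ?_
  · -- the old kernel, read on `π₁ A → π₁ A^H ↪ π₁ V₀`
    rw [hK]
    exact ker_comp_coe_eq_preimage_comap θA (inclHomOfSubset hAW₀ x₀ hxA (hAW₀ hxA)) μ₀ hμ₀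
      (inclHomOfSubset hW₀V₀ x₀ (hAW₀ hxA) (hW₀V₀ (hAW₀ hxA))) (inclHomOfSubset hAAH x₀ hxA hxAH)
      (inclHomOfSubset hAHV₀ x₀ hxAH (hAHV₀ hxAH)) hjA
      (by rw [inclHomOfSubset_comp, inclHomOfSubset_comp])
  · rw [hkP, preimage_mk_s4Kernels]
  · refine MonoidHom.ext fun x => ?_
    have e1 := DFunLike.congr_fun hμ'A x
    simp only [MonoidHom.comp_apply, MulEquiv.coe_toMonoidHom] at e1 ⊢
    rw [e1, inclHomOfSubset_inclHomOfSubset, inclHomOfSubset_inclHomOfSubset]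
  · refine MonoidHom.ext fun x => ?_
    have e1 := DFunLike.congr_fun hμ'P x
    simp only [MonoidHom.comp_apply, MulEquiv.coe_toMonoidHom] at e1 ⊢
    rw [e1, inclHomOfSubset_inclHomOfSubset, inclHomOfSubset_inclHomOfSubset]

end Slot

/-! ### Assembly in the language of Gay–Kirby trisections -/

section Assembly

variable {X : Type u} [TopologicalSpace X] [ChartedSpace (EuclideanSpace ℝ (Fin 4)) X]

omit [ChartedSpace (EuclideanSpace ℝ (Fin 4)) X] in
/-- Mathlib's map induced by the inclusion of the central surface in the `i`-th handlebody
(`centralInclusion`) is the tree's `VanKampen.inclHomOfSubset` for `⋂ l, S l ⊆ S (i+1) ∩ S (i+2)`.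
[folklore] -/
theorem map_centralInclusion_eq_inclHomOfSubset (S : Fin 3 → Set X) (i : Fin 3)
    (x₀ : X) (hx₀ : x₀ ∈ ⋂ l, S l) :
    _root_.FundamentalGroup.map (centralInclusion S i) (⟨x₀, hx₀⟩ : centralSurface S) =
      inclHomOfSubset (iInter_subset_inter S i) x₀ hx₀ (iInter_subset_inter S i hx₀) := by
  rw [_root_.FundamentalGroup.map_eq_mapOfEq]
  rfl

/-- The `i`-th kernel of `𝒢(h, x₀, μ)` is `μ⁻¹` of the kernel of the tree's inclusion-induced map
`π₁(⋂ l, S l) → π₁(S (i+1) ∩ S (i+2))`. [folklore] -/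
theorem groupGKTrisectionOf_apply_eq_comap_ker_inclHomOfSubset {g : ℕ} {k : Fin 3 → ℕ}
    {S : Fin 3 → Set X} (h : IsGKTrisection X g k S) (x₀ : X) (hx₀ : x₀ ∈ ⋂ l, S l)
    (μ : SurfaceGroup g ≃* _root_.FundamentalGroup (centralSurface S) ⟨x₀, hx₀⟩) (i : Fin 3) :
    groupGKTrisectionOf h ⟨x₀, hx₀⟩ μ i =
      ((inclHomOfSubset (iInter_subset_inter S i) x₀ hx₀ (iInter_subset_inter S i hx₀)).ker).comap
        μ.toMonoidHom := by
  rw [← map_centralInclusion_eq_inclHomOfSubset]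
  rfl

/-- **The `π₁` stage of the geometric half of (c′), assembled.**  Let `S` (genus `g`) and `S′`
(genus `g + 3`) be Gay–Kirby trisections of `X` and `x₀ ∈ X`.  Suppose (all sets are subsets of
`X`, all maps of fundamental groups are induced by inclusions):
* the new central surface is a closed cover `⋂ l, S′ l = A ∪ P` meeting exactly in `C ∋ x₀`, with
  collars of `C` in `A` and in `P`, `A`, `P`, `C` path connected, `π₁(C, x₀)` generated by one
  element `t`, and `A ⊆ ⋂ l, S l` (the old central surface minus a disc);
* free bases `θ_A : F⟨a₁,…,b_g⟩ ≃* π₁(A, x₀)` with `θ_A(r_g) = t` and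
  `θ_P : F⟨a₁,…,b₃⟩ ≃* π₁(P, x₀)` with `θ_P(r₃) = t⁻¹`, and a marking `μ₀` of the old central
  surface at `x₀` reading words through `θ_A`;
* for each `i`, the new handlebody is a closed cover `S′(i+1) ∩ S′(i+2) = A^Hᵢ ∪ B^Hᵢ` meeting
  exactly in `Eᵢ ∋ x₀` with collars, `A^Hᵢ`, `B^Hᵢ`, `Eᵢ` path connected, `π₁(Eᵢ, x₀) = 1`,
  `A ⊆ A^Hᵢ ⊆ S(i+1) ∩ S(i+2)`, `P ⊆ B^Hᵢ`, with `π₁ A → π₁(S(i+1) ∩ S(i+2))` onto (the old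
  handlebody is carried by the punctured old surface), `π₁ A^Hᵢ → π₁(S(i+1) ∩ S(i+2))` injective
  (a half-ball bite, `VanKampen.bijective_of_closed_cover_collars_of_subsingleton`), and
  `π₁ P → π₁ B^Hᵢ` onto with kernel (read through `θ_P`) the normal closure of the cut curves
  `s4Gens i` and `r₃`.
Then there is a marking `μ′` of the central surface of `S′` at `x₀` with
`𝒢(h′, x₀, μ′) = (𝒢(h, x₀, μ₀)).stabilize` on the nose — Gay–Kirby's Lemma 10 / Abrams–Gay–Kirby's
Thm. 5 ("connected sums of group trisections map to connected sums of 4-manifold trisections")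
at the level of `π₁`, granted the decomposition.
[cite: AbramsGayKirby2018, Def. 3 (p. 1540) and Thm. 5 (p. 1541)]
[cite: GayKirby2016, Def. 8 and Lemma 10 (p. 3100)] -/
theorem exists_marking_groupGKTrisectionOf_eq_stabilize {g : ℕ} {k k' : Fin 3 → ℕ}
    {S S' : Fin 3 → Set X} (h : IsGKTrisection X g k S) (h' : IsGKTrisection X (g + 3) k' S')
    {x₀ : X}
    -- the new central surface `F′ = A ∪_C P`
    {A P C CA CP OA OP : Set X}
    (hA : IsClosed A) (hP : IsClosed P) (hCA : C ⊆ A) (hCP : C ⊆ P) (hC : A ∩ P ⊆ C)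
    (hOA : IsOpen OA) (hCAe : CA = A ∩ OA) (hCCA : C ⊆ CA)
    (hOP : IsOpen OP) (hCPe : CP = P ∩ OP) (hCCP : C ⊆ CP)
    (hsdrCA : Literature.AlgebraicTopology.Homotopy.IsStrongDeformationRetractOf C CA)
    (hsdrCP : Literature.AlgebraicTopology.Homotopy.IsStrongDeformationRetractOf C CP)
    (hApc : IsPathConnected A) (hPpc : IsPathConnected P) (hCpc : IsPathConnected C)
    (hx₀ : x₀ ∈ C) (eF' : A ∪ P = ⋂ l, S' l) (hAF : A ⊆ ⋂ l, S l)
    (t : _root_.FundamentalGroup C ⟨x₀, hx₀⟩) (ht : Subgroup.closure {t} = ⊤)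
    -- free bases and the old marking
    (θA : FreeGroup (surfaceGen g) ≃* _root_.FundamentalGroup A ⟨x₀, hCA hx₀⟩)
    (θP : FreeGroup (surfaceGen 3) ≃* _root_.FundamentalGroup P ⟨x₀, hCP hx₀⟩)
    (hθA : θA (surfaceRelator g) = inclHomOfSubset hCA x₀ hx₀ (hCA hx₀) t)
    (hθP : θP (surfaceRelator 3) = (inclHomOfSubset hCP x₀ hx₀ (hCP hx₀) t)⁻¹)
    (μ₀ : SurfaceGroup g ≃* _root_.FundamentalGroup (centralSurface S) ⟨x₀, hAF (hCA hx₀)⟩)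
    (hμ₀ : μ₀.toMonoidHom.comp (PresentedGroup.mk _) =
      (inclHomOfSubset hAF x₀ (hCA hx₀) (hAF (hCA hx₀))).comp θA.toMonoidHom)
    -- the new handlebodies `H′ᵢ = A^Hᵢ ∪_{Eᵢ} B^Hᵢ`
    (AH BH E CAH CBH OAH OBH : Fin 3 → Set X)
    (hAH : ∀ i, IsClosed (AH i)) (hBH : ∀ i, IsClosed (BH i)) (hEAH : ∀ i, E i ⊆ AH i)
    (hEBH : ∀ i, E i ⊆ BH i) (hE : ∀ i, AH i ∩ BH i ⊆ E i)
    (hOAH : ∀ i, IsOpen (OAH i)) (hCAHe : ∀ i, CAH i = AH i ∩ OAH i) (hECAH : ∀ i, E i ⊆ CAH i)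
    (hOBH : ∀ i, IsOpen (OBH i)) (hCBHe : ∀ i, CBH i = BH i ∩ OBH i) (hECBH : ∀ i, E i ⊆ CBH i)
    (hsdrA : ∀ i, Literature.AlgebraicTopology.Homotopy.IsStrongDeformationRetractOf (E i) (CAH i))
    (hsdrB : ∀ i, Literature.AlgebraicTopology.Homotopy.IsStrongDeformationRetractOf (E i) (CBH i))
    (hAHpc : ∀ i, IsPathConnected (AH i)) (hBHpc : ∀ i, IsPathConnected (BH i))
    (hEpc : ∀ i, IsPathConnected (E i)) (hx₀E : ∀ i, x₀ ∈ E i)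
    (hE1 : ∀ i, Subsingleton (_root_.FundamentalGroup (E i) ⟨x₀, hx₀E i⟩))
    (eH' : ∀ i, AH i ∪ BH i = S' (i + 1) ∩ S' (i + 2))
    (hAAH : ∀ i, A ⊆ AH i) (hAHH : ∀ i, AH i ⊆ S (i + 1) ∩ S (i + 2)) (hPBH : ∀ i, P ⊆ BH i)
    -- the geometric `π₁` inputs
    (hsAH : ∀ i, Function.Surjective
      (inclHomOfSubset ((hAAH i).trans (hAHH i)) x₀ (hCA hx₀) (hAHH i (hAAH i (hCA hx₀)))))
    (hjA : ∀ i, Function.Injective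
      (inclHomOfSubset (hAHH i) x₀ (hAAH i (hCA hx₀)) (hAHH i (hAAH i (hCA hx₀)))))
    (hsP : ∀ i, Function.Surjective (inclHomOfSubset (hPBH i) x₀ (hCP hx₀) (hPBH i (hCP hx₀))))
    (hkP : ∀ i, (((inclHomOfSubset (hPBH i) x₀ (hCP hx₀) (hPBH i (hCP hx₀))).comp
        θP.toMonoidHom).ker : Set (FreeGroup (surfaceGen 3))) =
      (normalClosure (FreeGroup.of '' (s4Gens i : Set (surfaceGen 3)) ∪ {surfaceRelator 3}) :
        Set (FreeGroup (surfaceGen 3)))) :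
    ∃ (hx₀' : x₀ ∈ ⋂ l, S' l)
      (μ' : SurfaceGroup (g + 3) ≃* _root_.FundamentalGroup (centralSurface S') ⟨x₀, hx₀'⟩),
      groupGKTrisectionOf h' ⟨x₀, hx₀'⟩ μ' = (groupGKTrisectionOf h ⟨x₀, hAF (hCA hx₀)⟩ μ₀).stabilize := by
  -- the marking of the new central surface
  obtain ⟨hxW, hAW, hPW, μ', hμ'A, hμ'P⟩ := exists_marking_of_closed_cover_collars hA hP hCA hCP hC
    hOA hCAe hCCA hOP hCPe hCCP hsdrCA hsdrCP hApc hPpc hCpc hx₀ eF' t ht θA θP hθA hθP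
  refine ⟨hxW, μ', funext fun i => ?_⟩
  haveI := hE1 i
  have hWV : (⋂ l, S' l) ⊆ S' (i + 1) ∩ S' (i + 2) := iInter_subset_inter S' i
  rw [groupGKTrisectionOf_apply_eq_comap_ker_inclHomOfSubset h' x₀ hxW μ' i]
  refine comap_ker_eq_stabilize_of_closed_covers (hAH i) (hBH i) (hEAH i) (hEBH i) (hE i) (hOAH i)
    (hCAHe i) (hECAH i) (hOBH i) (hCBHe i) (hECBH i) (hsdrA i) (hsdrB i) (hAHpc i) (hBHpc i)
    (hEpc i) (hx₀E i) (eH' i) (hCA hx₀) (hCP hx₀) hAF (iInter_subset_inter S i) (hAAH i) (hAHH i)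
    (hPBH i) hAW hPW hWV θA.toMonoidHom θP.toMonoidHom μ₀ hμ₀ μ' hμ'A hμ'P _ i ?_ ?_ (hjA i) ?_ (hkP i)
  · exact groupGKTrisectionOf_apply_eq_comap_ker_inclHomOfSubset h x₀ (hAF (hCA hx₀)) μ₀ i
  · -- `π₁ A → π₁ A^Hᵢ` is onto: `π₁ A → π₁ Hᵢ` is onto and `π₁ A^Hᵢ → π₁ Hᵢ` is injective
    rw [MonoidHom.coe_comp, MulEquiv.coe_toMonoidHom]
    refine Function.Surjective.comp (fun y => ?_) θA.surjective
    obtain ⟨x, hx⟩ := hsAH i (inclHomOfSubset (hAHH i) x₀ (hAAH i (hCA hx₀))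
      (hAHH i (hAAH i (hCA hx₀))) y)
    refine ⟨x, hjA i ?_⟩
    rw [inclHomOfSubset_inclHomOfSubset, hx]
  · rw [MonoidHom.coe_comp, MulEquiv.coe_toMonoidHom]
    exact (hsP i).comp θP.surjective

/-- **The hypothesis `hgeom` of the glue theorems, from the `π₁` stage.**  In the situation of
`exists_marking_groupGKTrisectionOf_eq_stabilize` with `S` balanced of type `(g, k)` and `S′`
balanced of type `(g+3, k+1)`, the stabilised trisection `S′` witnesses the geometric hypothesis
of `exists_stabilized_gkTrisection_of_lift` for the marked trisection `(S, x₀, μ₀)`.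
[cite: AbramsGayKirby2018, Def. 3 (p. 1540) and Thm. 5 (p. 1541)] -/
theorem exists_iso_stabilize_of_marking_eq {g k : ℕ} {S S' : Fin 3 → Set X}
    (h : IsBalancedGKTrisection X g k S) (h' : IsBalancedGKTrisection X (g + 3) (k + 1) S')
    {x₀ : X} (hx₀ : x₀ ∈ ⋂ l, S l)
    (μ₀ : SurfaceGroup g ≃* _root_.FundamentalGroup (centralSurface S) ⟨x₀, hx₀⟩)
    (hπ₁ : ∃ (hx₀' : x₀ ∈ ⋂ l, S' l)
      (μ' : SurfaceGroup (g + 3) ≃* _root_.FundamentalGroup (centralSurface S') ⟨x₀, hx₀'⟩),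
      groupGKTrisectionOf h' ⟨x₀, hx₀'⟩ μ' = (groupGKTrisectionOf h ⟨x₀, hx₀⟩ μ₀).stabilize) :
    ∃ (S'' : Fin 3 → Set X) (h'' : IsBalancedGKTrisection X (g + 3) (k + 1) S'')
      (x₀'' : centralSurface S'')
      (μ'' : SurfaceGroup (g + 3) ≃* _root_.FundamentalGroup (centralSurface S'') x₀''),
      TrisectionKernels.Iso (groupGKTrisectionOf h'' x₀'' μ'')
        (groupGKTrisectionOf h ⟨x₀, hx₀⟩ μ₀).stabilize := by
  obtain ⟨hx₀', μ', hK⟩ := hπ₁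
  exact exists_iso_stabilize_of_eq _ ⟨S', h', ⟨x₀, hx₀'⟩, μ', hK⟩

end Assembly

end Literature.Topology.FourManifolds
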